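import Summits.CriticalPhenomena.PercolationContinuityZ3.Theorems.FK.Transplant.UFSC0FreeSlabReach
import Summits.CriticalPhenomena.PercolationContinuityZ3.Theorems.FK.Transplant.KNFreeSeedsFkLaw
import Literature.Probability.Percolation.StaticRenormalizationBoxes
import HarnessLib

/-!
# FRONTIER TRANSPLANT — K1 in finite form (K1-FIN), piece (P3b): gluing — from an occupied macro-site to a PRESCRIBED
# point of the slab box by insertion tolerance, at a cost uniform in the box

Support file (`--supports stmt-CriticalPhenomena-4575`, helper) of the FRONTIER TRANSPLANT sub-cell
(`fk-continuity/transplant/`, seat `prim-bschramm-fkt-p3`); builds on p205010 (kernel theorem, internal audit signed;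
external expert review pending). Memo row K1-FIN [g130, R67] (bytes-first package). 0 named facts · 0 sorries ·
standard axioms; `FH` does not occur in this file; `UFSC0`'s two clauses enter as displayed hypotheses.
Registered R70 (cell INBOX l.5267, 2026-08-23); registry row T4k; lead label T4k-08 (fkt-lead L44, l.5255).
Gate-prescribed dedup (dry-run probe `dedup.landed`, 2026-08-23T22:31Z; R70 (γ) stated delta): the private copy
`openConnIn_trans'` is deleted in favour of the landed `Literature.Probability.Percolation.GM.openConnIn_trans` (`SeedLemma`).

HONEST FRAMING (page 1, cell rule). The transplant's theorem of record `ufsc0_of_freeBoundaryHypothesis_r3` is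
CONDITIONAL on FH AND on TP_FK, both OPEN at the same `p` for `q > 1` (⇔ GRC Conj. (5.103) via K1; barrier note
`Literature.Barriers.CriticalPhenomena.SamePFreeBoundaryCriteria`, FBN-01); the transplant is a typed reduction, not a
proof of FK continuity. K1-FIN (`(∃ r, UFSC0) ⟹ (∃ L, Π(p, L))`) changes nothing in the record (`_r3` « 2 / 0 ☑ »,
n_open = 2).

## What is here (namespace `Summit.CriticalPhenomena.PercolationContinuityZ3.Theorems.FK`)

* §1 `fkLaw_restrW_lattW_ae_inside` (a.s. every open pair is a lattice edge inside `Λ`), `restrW_lattW_of_mem_edgesIn`,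
  `pow_card_le_fkLaw_real_initEvent` (`π^{|U₀|} ≤ μ_Λ(A₀)`, `π = p/(p+q(1-p))`, by insertion tolerance `ins_tolerance_fkLaw`);
* §2 `glueBox S N y` (the slab box cut to planar distance `66r` of `cen y`), `glueEdges`, `card_glueEdges_le` (uniform in
  `N`, `y`), `pathIn_of_adj_closed`, and the deterministic **`union_glueEdges_mem_openConnIn`**: on `A₀`, for a
  configuration of lattice edges inside `Λ_N` whose final macro-cluster contains `y`, opening all lattice edges of
  `glueBox S N y` joins `0` to every `x ∈ Λ_N` within planar distance `50r` of `cen y`, inside `Λ_N`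
  (`RunFK.exists_pathIn_near_of_mem_occFinal` + a lattice path in the box, `exists_walk_Icc`);
* §3 **`SameP.le_fkLaw_slabBox_real_openConnIn`**: under the free law of `Λ_N`, `4ε₀ ≤ 2⁻³²`, `20r(n+1) + 10r + 1 ≤ N`,
  `y ∈ Λ_n`, `x ∈ Λ_N` within planar distance `50r` of `cen y`:
  `(5/6) · π^{|glueEdges| + |U₀|} ≤ φ⁰_{Λ_N}(0 ↔ x in Λ_N)` (files (P2c)/(P3a) + insertion tolerance).

## References

* G. Grimmett, *The Random-Cluster Model*, Springer 2006, Thm. (3.1) eq. (3.4) (finite energy), §5.7 (5.102) [Grimmett2006].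
* G. Kozma, S. Nitzan, arXiv:2401.12397 (2024), §4 pp. 25–28 [KozmaNitzan2024].
-/

noncomputable section

namespace Summit.CriticalPhenomena.PercolationContinuityZ3.Theorems.FK

open MeasureTheory Literature.Probability.Percolation Literature.Probability.LatticeModels
open Literature.Probability.Percolation.ProbeHistory Literature.Probability.Percolation.HSiteScheme
open Literature.Probability.Percolation.KozmaNitzan Literature.Probability.Percolation.GadgetSystem
open KSch Cells
open scoped ENNReal Classical

variable {d : ℕ} {S : KSch d} {q : ℝ}

/-! ### §1 The free law of a region: almost sure support, weights, the initial event -/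

/-- **Under the free law of `Λ`, almost surely every open pair is a lattice edge with both endpoints in `Λ`** (pairs of
weight `0` are a.s. closed; the free weighting is `p` exactly on the lattice edges inside `Λ`). [cite: Grimmett2006, Thm. (3.7); §4.2] -/
theorem fkLaw_restrW_lattW_ae_inside (Λ : Finset (Site d)) (p : unitInterval) {q : ℝ} (hq : 1 ≤ q) :
    ∀ᵐ ω ∂(fkLaw Λ (restrW (↑Λ : Set (Site d)) (lattW d p)) q),
      ∀ e ∈ ω, e ∈ (zdGraph d).edgeSet ∧ ∀ z ∈ e, z ∈ Λ := by
  set W := restrW (↑Λ : Set (Site d)) (lattW d p) with hW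
  haveI := (isPinningLaw_fkLaw Λ hq).prob W
  have h0 := fkLaw_real_compl_setOf_weight_zero Λ W hq
  have hnull : (fkLaw Λ W q) {η : BondConfig (Site d) | ∀ x : Sym2 (Site d), W x = 0 → x ∉ η}ᶜ = 0 :=
    (measureReal_eq_zero_iff (measure_ne_top _ _)).1 h0
  rw [ae_iff]
  refine measure_mono_null (fun ω hω => ?_) hnull
  simp only [Set.mem_setOf_eq, Set.mem_compl_iff, not_forall, not_not] at hω ⊢
  obtain ⟨e, heω, he⟩ := hω
  refine ⟨e, ?_, heω⟩
  by_contra hWe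
  apply he
  have hw : e ∈ wireSet (↑Λ : Set (Site d)) := by
    by_contra hw; exact hWe (by rw [hW, restrW_apply_of_not_mem _ hw])
  refine ⟨?_, fun z hz => Finset.mem_coe.1 (hw.1 z hz)⟩
  rw [hW, restrW_apply_of_mem _ hw] at hWe
  induction e using Sym2.ind with
  | h x y =>
    rw [lattW_mk] at hWe
    by_contra hadj
    rw [SimpleGraph.mem_edgeSet] at hadj
    exact hWe (by rw [if_neg hadj])

/-- **The free weighting of `Λ` is `p` on the lattice edges inside `Λ`.** [cite: Grimmett2006, §1.4 eq. (1.20)] -/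
theorem restrW_lattW_of_mem_edgesIn {Λ R : Finset (Site d)} (hR : R ⊆ Λ) (p : unitInterval) {e : Sym2 (Site d)}
    (he : e ∈ edgesIn (zdGraph d) R) : restrW (↑Λ : Set (Site d)) (lattW d p) e = p := by
  rw [mem_edgesIn_iff] at he
  induction e using Sym2.ind with
  | h x y =>
    have hadj : (zdGraph d).Adj x y := (SimpleGraph.mem_edgeSet _).1 he.1
    have hw : s(x, y) ∈ wireSet (↑Λ : Set (Site d)) :=
      mk_mem_wireSet_iff.2 ⟨Finset.mem_coe.2 (hR (he.2 x (Sym2.mem_mk_left _ _))),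
        Finset.mem_coe.2 (hR (he.2 y (Sym2.mem_mk_right _ _))), hadj.ne⟩
    rw [restrW_apply_of_mem _ hw, lattW_mk, if_pos hadj]

/-- **The initial event costs at most `π^{|U₀|}`**: under the free law of a region `Λ ⊇ Q_0`,
`(p/(p+q(1-p)))^{|U₀|} ≤ μ_Λ(A₀)` (insertion tolerance: opening the edges of `Q_0` realises `A₀` from anything).
[cite: Grimmett2006, Thm. (3.1) eq. (3.4); KozmaNitzan2024, §4 p. 27 (G₀ = {0} if Q_0 is open)] -/
theorem pow_card_le_fkLaw_real_initEvent (hq : 1 ≤ q) {Λ : Finset (Site d)} (hQ : S.C.Q 0 ⊆ Λ) :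
    ((S.p : ℝ) / (S.p + q * (1 - S.p))) ^ S.U₀.card ≤
      (fkLaw Λ (restrW (↑Λ : Set (Site d)) (lattW d S.p)) q).real (schemeFK S q).initEvent := by
  set μ := fkLaw Λ (restrW (↑Λ : Set (Site d)) (lattW d S.p)) q with hμ
  haveI : IsProbabilityMeasure μ := (isPinningLaw_fkLaw Λ hq).prob _
  have hU : ∀ e ∈ S.U₀, restrW (↑Λ : Set (Site d)) (lattW d S.p) e = S.p := fun e he =>
    restrW_lattW_of_mem_edgesIn hQ S.p he
  have hUΛ : ∀ e ∈ S.U₀, ∀ z ∈ e, z ∈ Λ := fun e he z hz => hQ ((mem_edgesIn_iff.1 he).2 z hz)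
  have h := KNFree.ins_tolerance_fkLaw hq Λ _ hU hUΛ (measurableSet_initEvent (S := schemeFK S q))
  have huniv : (fun ω : BondConfig (Site d) => ω ∪ ↑S.U₀) ⁻¹' (schemeFK S q).initEvent = Set.univ := by
    ext ω
    simp only [Set.mem_preimage, HSiteScheme.initEvent, Set.mem_setOf_eq, Set.mem_univ, iff_true]
    exact Set.subset_union_right
  rw [huniv, ← hμ, probReal_univ, mul_one] at h
  exact h

/-! ### §2 The glue box of a macro-site and the deterministic gluing -/

/-- The glue radius `66r` in every coordinate. [folklore] -/
def glueRad (S : KSch d) : Site d := fun _ => 66 * S.C.r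

/-- **The glue box of the macro-site `y`**: the part of the slab box `Λ_N` within `66r` of `cen y` in every coordinate (an
order interval). [cite: Grimmett2006, §5.7 (connections inside S(L, n))] -/
def glueBox (S : KSch d) (N : ℕ) (y : Site 2) : Finset (Site d) :=
  Finset.Icc ((-slabW S N) ⊔ (S.C.cen y - glueRad S)) (slabW S N ⊓ (S.C.cen y + glueRad S))

/-- The lattice edges inside the glue box (the edges opened by the gluing). [cite: Grimmett2006, Thm. (3.1) eq. (3.4)] -/
def glueEdges (S : KSch d) (N : ℕ) (y : Site 2) : Finset (Sym2 (Site d)) := edgesIn (zdGraph d) (glueBox S N y)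

/-- The glue box lies in the slab box. [folklore] -/
theorem glueBox_subset_slabBox (N : ℕ) (y : Site 2) : glueBox S N y ⊆ slabBox S N :=
  Finset.Icc_subset_Icc le_sup_left inf_le_left

/-- The glue box lies in the cube of radius `66r` around `cen y`. [folklore] -/
theorem glueBox_subset_Icc (N : ℕ) (y : Site 2) :
    glueBox S N y ⊆ Finset.Icc (S.C.cen y - glueRad S) (S.C.cen y + glueRad S) :=
  Finset.Icc_subset_Icc le_sup_right inf_le_right

/-- **The number of glue edges is bounded uniformly in `N` and `y`**: `≤ 2d (132r + 1)^d`. [folklore] -/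
theorem card_glueEdges_le (N : ℕ) (y : Site 2) : (glueEdges S N y).card ≤ 2 * d * (132 * S.C.r + 1) ^ d := by
  have h1 := card_edgesIn_le (d := d) (glueBox S N y)
  have h2 : (glueBox S N y).card ≤ (132 * S.C.r + 1) ^ d := by
    refine (Finset.card_le_card (glueBox_subset_Icc N y)).trans ?_
    rw [Pi.card_Icc]
    have hc : ∀ i, (Finset.Icc ((S.C.cen y - glueRad S) i) ((S.C.cen y + glueRad S) i)).card = 132 * S.C.r + 1 := by
      intro i
      rw [Int.card_Icc]
      simp only [Pi.sub_apply, Pi.add_apply, glueRad]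
      omega
    simp only [hc, Finset.prod_const, Finset.card_univ, Fintype.card_fin, le_refl]
  exact h1.trans (Nat.mul_le_mul_left _ h2)

/-- Every coordinate is planar (`pax 0`, `pax 1`) or transverse. [folklore] -/
theorem forall_coord (P : Fin d → Prop) (h0 : P (S.C.pax 0)) (h1 : P (S.C.pax 1))
    (hthin : ∀ j, j ≠ S.C.ax0 → j ≠ S.C.ax1 → P j) : ∀ j, P j := by
  intro j
  by_cases hj0 : j = S.C.ax0
  · have : S.C.pax 0 = S.C.ax0 := by unfold Cells.pax; rw [if_pos rfl]
    rw [hj0, ← this]; exact h0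
  · by_cases hj1 : j = S.C.ax1
    · have : S.C.pax 1 = S.C.ax1 := by unfold Cells.pax; rw [if_neg (by decide)]
      rw [hj1, ← this]; exact h1
    · exact hthin j hj0 hj1

/-- **Membership in the glue box** from membership in the slab box and planar distance `≤ 66r` to `cen y`. [folklore] -/
theorem mem_glueBox_of {N : ℕ} {y : Site 2} {z : Site d} (hz : z ∈ slabBox S N)
    (hpl : ∀ i : Fin 2, |z (S.C.pax i) - 20 * S.C.r * y i| ≤ 66 * S.C.r) : z ∈ glueBox S N y := by
  have hzw := mem_slabBox_iff.1 hz
  have hr : (0 : ℤ) ≤ S.C.r := by positivity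
  have hnear : ∀ j, |z j - S.C.cen y j| ≤ 66 * S.C.r := by
    refine forall_coord (S := S) (fun j => |z j - S.C.cen y j| ≤ 66 * S.C.r) ?_ ?_ fun j h0 h1 => ?_
    · rw [S.C.cen_pax]; exact hpl 0
    · rw [S.C.cen_pax]; exact hpl 1
    · rw [S.C.cen_of_ne y h0 h1, sub_zero]
      have := hzw j
      rw [slabW_of_ne S N h0 h1] at this
      linarith
  rw [glueBox, Finset.mem_Icc]
  constructor <;> intro j
  · simp only [Pi.sup_apply, Pi.neg_apply, Pi.sub_apply, glueRad, sup_le_iff]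
    have h1 := abs_le.1 (hzw j); have h2 := abs_le.1 (hnear j)
    constructor <;> linarith [h1.1, h2.1]
  · simp only [Pi.inf_apply, Pi.add_apply, glueRad, le_inf_iff]
    have h1 := abs_le.1 (hzw j); have h2 := abs_le.1 (hnear j)
    constructor <;> linarith [h1.2, h2.2]

/-- **A path can be re-targeted to any set containing its start and closed under the adjacency of the graph.** [folklore] -/
theorem pathIn_of_adj_closed {V : Type*} {G : SimpleGraph V} {A B : Set V} {u v : V} (hu : u ∈ B)
    (hB : ∀ a b, G.Adj a b → b ∈ B) (h : PathIn G A u v) : PathIn G B u v := by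
  obtain ⟨-, hr⟩ := h
  refine ⟨hu, ?_⟩
  induction hr with
  | refl => exact Relation.ReflTransGen.refl
  | tail _ hbc ih => exact ih.tail ⟨hbc.1, hB _ _ hbc.1⟩

-- Transitivity of `{x ↔ y in S}`: the landed `Literature.Probability.Percolation.GM.openConnIn_trans`
-- (module `SeedLemma`, already in the import closure) is reused (gate-prescribed dedup).

/-- **Deterministic gluing.** On the initial event, let `ω` consist of lattice edges inside the slab box `Λ_N`, and let the
macro-site `y` belong to the final macro-cluster of Kozma–Nitzan's FK run on `ω`. Then for every `x ∈ Λ_N` within planar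
distance `50r` of `cen y`, the configuration `ω ∪ glueEdges S N y` joins `0` to `x` INSIDE `Λ_N`: the certified open path
from `0` to a point `a` near `cen y` (`RunFK.exists_pathIn_near_of_mem_occFinal`) runs inside `Λ_N` (its edges are in `ω`),
and `a`, `x` lie in the glue box, an order interval, hence are joined by a lattice path inside it (`exists_walk_Icc`), all
of whose edges are glue edges. [cite: KozmaNitzan2024, §4 pp. 26–28 ((3)); Grimmett2006, §5.7] -/
theorem union_glueEdges_mem_openConnIn (hq : 1 ≤ q) (hδc : S.δc ≤ 1) (hQ0 : ∀ du : MDir, OriginFK S q du) {N : ℕ}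
    {ω : BondConfig (Site d)} (hA : ω ∈ (schemeFK S q).initEvent)
    (hωΛ : ∀ e ∈ ω, e ∈ (zdGraph d).edgeSet ∧ ∀ z ∈ e, z ∈ slabBox S N)
    {y : Site 2} (hy : y ∈ (schemeFK S q).occFinal ω) {x : Site d} (hx : x ∈ slabBox S N)
    (hxy : ∀ i : Fin 2, |x (S.C.pax i) - 20 * S.C.r * y i| ≤ 50 * S.C.r) :
    ω ∪ ↑(glueEdges S N y) ∈ openConnIn (↑(slabBox S N) : Set (Site d)) 0 x := by
  have hr : (0 : ℤ) ≤ S.C.r := by positivity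
  obtain ⟨a, ⟨m, hpath⟩, hnear⟩ := RunFK.exists_pathIn_near_of_mem_occFinal hq hδc hQ0 hA hy
  -- the certified path runs inside the slab box
  have hpathΛ : PathIn (openGraph ω) (↑(slabBox S N) : Set (Site d)) 0 a :=
    pathIn_of_adj_closed (Finset.mem_coe.2 (zero_mem_slabBox S N))
      (fun u v huv => Finset.mem_coe.2 ((hωΛ _ ((openGraph_adj _ _ _).1 huv).1).2 v (Sym2.mem_mk_right _ _))) hpath
  have haΛ : a ∈ slabBox S N := Finset.mem_coe.1 hpathΛ.right_mem
  -- both `a` and `x` lie in the glue box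
  have ha : a ∈ glueBox S N y := mem_glueBox_of haΛ fun i => by
    have := hnear i; rw [abs_sub_comm] at this; linarith
  have hxg : x ∈ glueBox S N y := mem_glueBox_of hx fun i => (hxy i).trans (by linarith)
  -- a lattice path from `a` to `x` inside the glue box
  set lo : Site d := (-slabW S N) ⊔ (S.C.cen y - glueRad S) with hlo
  set hi : Site d := slabW S N ⊓ (S.C.cen y + glueRad S) with hhi
  have hmemI : ∀ z, z ∈ glueBox S N y ↔ z ∈ Set.Icc lo hi := fun z => by
    rw [glueBox, Finset.mem_Icc, Set.mem_Icc]
  obtain ⟨W, -, hW⟩ := exists_walk_Icc lo hi _ a x rfl ((hmemI a).1 ha) ((hmemI x).1 hxg)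
  -- part 1: `0 ↔ a` inside `Λ_N` in `ω ∪ F`
  have h1 : ω ∪ ↑(glueEdges S N y) ∈ openConnIn (↑(slabBox S N) : Set (Site d)) 0 a := by
    refine DCT16.mem_openConnIn_of_pathIn (DCT16.pathIn_congrGraph (fun u v _ _ huv => ?_) hpathΛ)
    rw [openGraph_adj] at huv ⊢
    exact ⟨Set.mem_union_left _ huv.1, huv.2⟩
  -- part 2: `a ↔ x` inside `Λ_N` along the glue edges
  have h2 : ω ∪ ↑(glueEdges S N y) ∈ openConnIn (↑(slabBox S N) : Set (Site d)) a x := by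
    refine mem_openConnIn_of_walk W (fun z hz => Finset.mem_coe.2 (glueBox_subset_slabBox N y ((hmemI z).2 (hW z hz))))
      fun e he => Set.mem_union_right _ (Finset.mem_coe.2 ?_)
    rw [glueEdges, mem_edgesIn_iff]
    refine ⟨W.edges_subset_edgeSet he, fun z hz => ?_⟩
    induction e using Sym2.ind with
    | h u v =>
      rcases Sym2.mem_iff.1 hz with rfl | rfl
      · exact (hmemI z).2 (hW z (W.fst_mem_support_of_mem_edges he))
      · exact (hmemI z).2 (hW z (W.snd_mem_support_of_mem_edges he))
  exact GM.openConnIn_trans h1 h2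

/-! ### §3 The two-point bound at a prescribed point near a good macro-site -/

namespace SameP

/-- **The free slab-box measure joins `0` to a prescribed point near a good macro-site**: under the free law `μ_N` of
`Λ_N` (`q ≥ 1`, `4ε₀ ≤ 2⁻³²`, `20r(n+1) + 10r + 1 ≤ N`), for `y ∈ Λ_n` and `x ∈ Λ_N` within planar distance `50r` of
`cen y`: `(5/6) π^{|glueEdges| + |U₀|} ≤ μ_N(0 ↔ x in Λ_N)`, `π = p/(p+q(1-p))` — `A₀` costs `π^{|U₀|}`, the run reaches `y`
with conditional probability `≥ 5/6` (file (P3a)), and opening the glue edges (insertion tolerance, Grimmett (3.4)) joins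
`0` to `x`. [cite: Grimmett2006, Thm. (3.1) eq. (3.4), §5.7 (5.102); KozmaNitzan2024, §4 Theorem 6] -/
theorem le_fkLaw_slabBox_real_openConnIn (hq : 1 ≤ q) {ε₀ : ℝ} (hε : 4 * ε₀ ≤ (1 / 2 : ℝ) ^ 32)
    (hδ1 : S.δc ≤ 1) (hQ0 : ∀ du : MDir, OriginFK S q du)
    (hbad : ∀ (h : ProbeHistory (Site d)) (e : Site 2 × MDir) (du : MDir), ValidFK S q h e →
      du ∈ S.onward h (tgt e) → (fkLaw (S.Sx h e du) (S.Wfull h e du) q).real (badFK S q h e du) ≤ ε₀)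
    {n N : ℕ} (hN : 20 * S.C.r * (n + 1) + 10 * S.C.r + 1 ≤ N) {y : Site 2} (hy : y ∈ box 2 n)
    {x : Site d} (hx : x ∈ slabBox S N) (hxy : ∀ i : Fin 2, |x (S.C.pax i) - 20 * S.C.r * y i| ≤ 50 * S.C.r) :
    5 / 6 * ((S.p : ℝ) / (S.p + q * (1 - S.p))) ^ ((glueEdges S N y).card + S.U₀.card) ≤
      (fkLaw (slabBox S N) (restrW (↑(slabBox S N) : Set (Site d)) (lattW d S.p)) q).real
        (openConnIn (↑(slabBox S N) : Set (Site d)) 0 x) := by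
  set Λ := slabBox S N with hΛ
  set μ := fkLaw Λ (restrW (↑Λ : Set (Site d)) (lattW d S.p)) q with hμ
  set π : ℝ := (S.p : ℝ) / (S.p + q * (1 - S.p)) with hπ
  set F := glueEdges S N y with hF
  haveI : IsProbabilityMeasure μ := (isPinningLaw_fkLaw Λ hq).prob _
  have hπ0 : 0 ≤ π := div_nonneg S.p.2.1 (insertionDenominator_pos S.p.2 hq).le
  -- `Q_0 ⊆ Λ_N`
  have hQ : S.C.Q 0 ⊆ Λ := by
    intro z hz
    obtain ⟨hpl, hth⟩ := planar_and_thin_of_mem_Cell (S := S) (zero_mem_box 2 0) (S.C.Q_subset_Cell 0 hz)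
    refine mem_slabBox_of_bounds hth fun i => (hpl i).trans ?_
    push_cast at hN ⊢
    have hr : (0 : ℤ) ≤ S.C.r := by positivity
    nlinarith
  -- the chain of inequalities
  have h1 : π ^ S.U₀.card ≤ μ.real (schemeFK S q).initEvent := pow_card_le_fkLaw_real_initEvent hq hQ
  have h2 := le_fkLaw_slabBox_real_initEvent_inter_mem hq hε hδ1 hQ0 hbad hN hy
  rw [← hΛ, ← hμ] at h2
  set E : Set (BondConfig (Site d)) := {ω | ∀ e ∈ ω, e ∈ (zdGraph d).edgeSet ∧ ∀ z ∈ e, z ∈ Λ} with hE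
  have hE0 : μ.real Eᶜ = 0 := by
    have hae := fkLaw_restrW_lattW_ae_inside Λ S.p hq
    rw [← hμ, ae_iff] at hae
    rw [measureReal_def, show Eᶜ = {ω | ¬∀ e ∈ ω, e ∈ (zdGraph d).edgeSet ∧ ∀ z ∈ e, z ∈ Λ} from rfl, hae,
      ENNReal.toReal_zero]
  set G : Set (BondConfig (Site d)) := (schemeFK S q).initEvent ∩ {ω | y ∈ (schemeFK S q).occFinal ω} ∩ E with hG
  have h3 : μ.real ((schemeFK S q).initEvent ∩ {ω | y ∈ (schemeFK S q).occFinal ω}) ≤ μ.real G := by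
    have hsub : (schemeFK S q).initEvent ∩ {ω | y ∈ (schemeFK S q).occFinal ω} ⊆ G ∪ Eᶜ := by
      intro ω hω
      by_cases hωE : ω ∈ E
      · exact Or.inl ⟨hω, hωE⟩
      · exact Or.inr hωE
    calc μ.real ((schemeFK S q).initEvent ∩ {ω | y ∈ (schemeFK S q).occFinal ω}) ≤ μ.real (G ∪ Eᶜ) := measureReal_mono hsub
      _ ≤ μ.real G + μ.real Eᶜ := measureReal_union_le _ _
      _ = μ.real G := by rw [hE0, add_zero]
  have h4 : G ⊆ (fun ω => ω ∪ ↑F) ⁻¹' openConnIn (↑Λ : Set (Site d)) 0 x := by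
    rintro ω ⟨⟨hA, hyω⟩, hωE⟩
    exact union_glueEdges_mem_openConnIn hq hδ1 hQ0 hA hωE hyω hx hxy
  have h5 : π ^ F.card * μ.real ((fun ω => ω ∪ ↑F) ⁻¹' openConnIn (↑Λ : Set (Site d)) 0 x) ≤
      μ.real (openConnIn (↑Λ : Set (Site d)) 0 x) :=
    KNFree.ins_tolerance_fkLaw hq Λ _ (fun e he => restrW_lattW_of_mem_edgesIn (glueBox_subset_slabBox N y) S.p he)
      (fun e he z hz => glueBox_subset_slabBox N y ((mem_edgesIn_iff.1 he).2 z hz))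
      (DCT16.measurableSet_openConnIn Λ 0 x)
  calc 5 / 6 * π ^ (F.card + S.U₀.card) = π ^ F.card * (5 / 6 * π ^ S.U₀.card) := by rw [pow_add]; ring
    _ ≤ π ^ F.card * (5 / 6 * μ.real (schemeFK S q).initEvent) := by gcongr
    _ ≤ π ^ F.card * μ.real ((schemeFK S q).initEvent ∩ {ω | y ∈ (schemeFK S q).occFinal ω}) :=
        mul_le_mul_of_nonneg_left h2 (pow_nonneg hπ0 _)
    _ ≤ π ^ F.card * μ.real G := mul_le_mul_of_nonneg_left h3 (pow_nonneg hπ0 _)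
    _ ≤ π ^ F.card * μ.real ((fun ω => ω ∪ ↑F) ⁻¹' openConnIn (↑Λ : Set (Site d)) 0 x) :=
        mul_le_mul_of_nonneg_left (measureReal_mono h4) (pow_nonneg hπ0 _)
    _ ≤ μ.real (openConnIn (↑Λ : Set (Site d)) 0 x) := h5

end SameP

end Summit.CriticalPhenomena.PercolationContinuityZ3.Theorems.FK

end
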